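import Literature.NumberTheory.Automorphic.GodementJacquetRankOneEntire
import Literature.NumberTheory.GaloisRepresentations.HeckeLFunctionMeromorphicContinuationProofs
import HarnessLib

/-!
# lang.S21 for `GL_1`, unconditionally: Godement–Jacquet's Thm. 13.8 for `L^S` at `n = 1` and the
# meromorphic form of lang.S21 for `GL_1(𝔸_K)`

Topic `NumberTheory/Automorphic`; namespace `Literature.NumberTheory.Automorphic`. Proof file
(theorems only: no definition, no named fact, no instance), a short leaf recording the rank-one
instances of two lang.S21 named facts which the rank-one discharges of the tree now settle:

* `CuspidalAutomorphicRepGL.heckeCharacter_ne_one_of_not_isTrivialSubrep` — a cuspidal `Π` of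
  `GL_1(𝔸_K)` which is not the trivial subrepresentation has Hecke character `χ_Π ≠ 1`
  (`R(g) φ = χ_Π(det g) φ` on `Π`, `rightRegular_apply_eq_heckeCharacter_det_smul` of
  `GodementJacquetRankOneEntire`); with `hasEntireContinuation_partialStandardL_gl_one` this gives
  `hasEntireContinuation_partialStandardL_of_not_isTrivialSubrep`: **`L^S(s, Π)` is entire for every
  non-trivial cuspidal `Π` of `GL_1`** (the entire half of lang.S21 at `GL_1`, without functional
  equation);
* `GodementJacquet1972_meromorphic_partialStandardL_one`, `godementJacquet_hasMeromorphicContinuation_one`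
  — **the named facts `GodementJacquet1972_meromorphic_partialStandardL` (`GodementJacquetPartialL`;
  Godement–Jacquet (1972), Thm. 13.8 for `L^S`, half-plane form) and
  `godementJacquet_hasMeromorphicContinuation` (`AutomorphicLFunctions`, lang.S21, meromorphic form)
  hold for `n = 1` over every number field**: the conditional `…_one_of_tate` of `GLOneStandardLTate`
  fed with Tate's theorem `heckeLFunction_hasMeromorphicContinuation_holds`
  (`HeckeLFunctionMeromorphicContinuationProofs`, itself Godement–Jacquet in rank one).

## References

* R. Godement, H. Jacquet, *Zeta functions of simple algebras*, LNM 260 (1972), Thm. 13.8.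
  [GodementJacquet1972]
* J. Tate, *Fourier analysis in number fields and Hecke's zeta-functions* (1950), in
  Cassels–Fröhlich (1967), Ch. XV, Thm. 4.4.1. [TateThesis1967]
-/

noncomputable section

open MeasureTheory NumberField IsDedekindDomain

namespace Literature.NumberTheory.Automorphic

variable {K : Type} [Field K] [NumberField K]
  {μ : Measure (AdelicGroupData.gl 1 K).automorphicQuotient} [(AdelicGroupData.gl 1 K).IsAutomorphicMeasure μ]

/-- **A non-trivial cuspidal `Π` of `GL_1(𝔸_K)` has `χ_Π ≠ 1`**: if `χ_Π = 1` then
`R(g) φ = χ_Π(det g) φ = φ` for all `φ ∈ Π`, i.e. `Π ≤ L²(X)^{GL_1(𝔸_K)}` is the trivial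
subrepresentation. [folklore] -/
theorem CuspidalAutomorphicRepGL.heckeCharacter_ne_one_of_not_isTrivialSubrep
    (P : CuspidalAutomorphicRepGL 1 K μ) (hP : ¬ P.1.IsTrivialSubrep) : P.heckeCharacter ≠ 1 := by
  intro h1
  apply hP
  intro f hf
  rw [ContRepresentation.mem_invariants]
  intro g
  have h := P.rightRegular_apply_eq_heckeCharacter_det_smul g hf
  rw [h1, GaloisRepresentations.HeckeCharacter.one_apply, Units.val_one, one_smul] at h
  exact h

/-- **`L^S(s, Π)` is entire for every non-trivial cuspidal `Π` of `GL_1(𝔸_K)`** and every honest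
Satake family off a finite `S` (`hasEntireContinuation_partialStandardL_gl_one`, Hecke–Tate from
Godement–Jacquet in rank one) — the entire half of lang.S21 at `GL_1`, the trivial representation
(where `L^S = ζ_K^S` has a pole) excluded as in `godementJacquet`.
[cite: GodementJacquet1972, Thm. 13.8] [cite: TateThesis1967, Thm. 4.4.1] -/
theorem hasEntireContinuation_partialStandardL_of_not_isTrivialSubrep (P : CuspidalAutomorphicRepGL 1 K μ)
    (hP : ¬ P.1.IsTrivialSubrep) {S : Finset (HeightOneSpectrum (𝓞 K))} {α : SatakeFamily K}
    (hα : IsSatakeFamilyOf P ↑S α) :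
    GaloisRepresentations.LFunction.HasEntireContinuation (partialStandardL ↑S α) :=
  hasEntireContinuation_partialStandardL_gl_one P (P.heckeCharacter_ne_one_of_not_isTrivialSubrep hP) S hα

/-- **Godement–Jacquet (1972), Thm. 13.8 for `L^S`, `n = 1`, unconditionally**: the named fact
`GodementJacquet1972_meromorphic_partialStandardL` of `GodementJacquetPartialL` for `n = 1` over every
number field (`…_one_of_tate` of `GLOneStandardLTate` fed with Tate's theorem
`heckeLFunction_hasMeromorphicContinuation_holds`). [cite: GodementJacquet1972, Thm. 13.8]
[cite: TateThesis1967, Thm. 4.4.1] -/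
theorem GodementJacquet1972_meromorphic_partialStandardL_one :
    GodementJacquet1972_meromorphic_partialStandardL (n := 1) (K := K) (μ := μ) :=
  GodementJacquet1972_meromorphic_partialStandardL_one_of_tate
    fun χ => GaloisRepresentations.heckeLFunction_hasMeromorphicContinuation_holds χ

/-- **lang.S21 (meromorphic `L(s, Π)`, all cuspidal `Π`) for `GL_1`, unconditionally**: the named
fact `godementJacquet_hasMeromorphicContinuation` of `AutomorphicLFunctions` for `n = 1` over every
number field (`…_one_of_tate` of `GLOneStandardLTate` fed with Tate's theorem
`heckeLFunction_hasMeromorphicContinuation_holds`). [cite: GodementJacquet1972, Thm. 13.8]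
[cite: TateThesis1967, Thm. 4.4.1] -/
theorem godementJacquet_hasMeromorphicContinuation_one :
    godementJacquet_hasMeromorphicContinuation (n := 1) (K := K) (μ := μ) :=
  godementJacquet_hasMeromorphicContinuation_one_of_tate
    fun χ => GaloisRepresentations.heckeLFunction_hasMeromorphicContinuation_holds χ

end Literature.NumberTheory.Automorphic
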